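import Summits.QuantumFields.YangMills.Theorems.UnitScaleTiltProp7ExactCorrectorMember
import Summits.QuantumFields.YangMills.Theorems.UnitScaleTiltProp7ChartRemainderHNShape
import Summits.QuantumFields.YangMills.Theorems.UnitScaleTiltProp7ChartRemainderBondShape
import Summits.QuantumFields.YangMills.Theorems.UnitScaleTiltProp7ChartRemainderZero
import Summits.QuantumFields.YangMills.Theorems.BalabanUVNodesN12RootedForestGeodesic
import Summits.QuantumFields.YangMills.Theorems.UnitScaleTiltProp7CovariantWeitzenbock
import HarnessLib

/-!
# Route `UnitScaleTilt`, crux K1 «MinimiserStabilityRegPr» (stmt-QuantumFields-19200), route-R E′ path (α′): THE (E1-c) → (E1-e) JUNCTION AT THE MEMBER —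
# the `N`-rows of ✓ `Prop7ExactCorrectorMember.exists_exact_corrector_member` (`hN0`, the Lipschitz row `hN` in the `q ∕ p` gauges, and the `T₂` rows `hT₂ hb₂`) from px15 g2's
# (E1-c) shape lemmas ✓ `Prop7ChartRemainderHNShape.norm_divB_chartRemainder_hN_shape`, ✓ `Prop7ChartRemainderBondShape.norm_chartRemainder_bond_hN_shape`,
# ✓ `Prop7ChartRemainderZero.chartRemainder_zero`, at run `K`, level `K − n`, `SU(2)` background `W` of a T³ family

Cell `ym3-torus`, width seat `ym3-torus-px13` (gen 3); ★p1 g16 NAMER WORD 3 (2026-08-28T23:25Z) «px13: JUNCTION GO» (letters: `Y := X^{u}`, chart `D = −i·mlog(Y W⁻¹)`, `d` = the torus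
potential of X-row 3).  THEOREMS ONLY (0 `def`, 0 `sorry`, 0 `instance`); `--supports stmt-QuantumFields-19200`, count-neutral.  YM₃ on T³ is a ladder rung (R3), not the Clay problem;
nothing here claims the stub, the crux, d = 4 or the gap.

LETTERS.  `𝒰 := fun κ z => unitsField (toUField W) ⟨z, κ⟩`, `T := torusT (F.P K) 0`, `ℓ := L^{K−n}` (real) = `((F.L ^ (K − n) : ℕ) : ℝ)` (px15's natural `ℓ`); the remainder in the
door's (Hermitian) currency is DISPLAYED by definition: `N ψ μ y = (−I)•(mlog(e^{cψ(y)}·E_μ(y)·(R(𝒰_μ(y)) e^{cψ(y+μ)})^*) − mlog E_μ(y) + c•(D_𝒰ψ)_μ(y))` for a scalar `c` with `‖c‖ ≤ 1`,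
`c̄ = −c` (the knit takes `c = ±I` to match `Y := X^{u}`, `u = e^{cψ}`) and unitary-chart data `E` (the knit takes `E_μ(y) := X‴_b W_b⁻¹`); the gauge is the MEMBER DOOR's
`p ψ = max ‖ψ‖ (max (ℓ‖D_𝒰ψ‖) (ℓ‖T₂ψ‖))` with px15's weighted letter `T₂ψ(x) := min(d x, ℓ)•D*_𝒰((−c)•D_𝒰ψ)(x)`; the size on bond fields is `q A := max (ℓ‖A‖) (ℓ²‖D*_𝒰A‖)`.

WHAT IS PROVED (ns `…Theorems.Prop7ExactCorrectorHNMember`).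
* §1 ★ `exists_torusPotential` — a potential `d : Site → ℕ`, `0` on the `k`-centres, `≤ tdist` to every centre, DESCENDING off the centres (px15's row `hd`; rank of the BFS rooted
  forest ✓ `N12RootedForestGeodesic.exists_geodesicForest`).
* §2 transport rows at a unitary background: `norm_R_eq`, `norm_R_inv_eq`, `star_R_eq`, `R_inv_star_eq` (+ ✓ `Prop7CovariantCoercivity.inv_mem_unitary`) (px15's `hR hRn hstarR hstarRinv`).
* §3 (J1) `hN0_member` (`N 0 = 0`); `exp_half_le_two` (numerics); ★★★ (J2) `hN_member` — for `ψ, ψ′ ∈ S` (pinned, Hermitian, traceless) with `p ψ, p ψ′ ≤ B`, `400B ≤ 1`, and data rows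
  `‖E − 1‖ < 1`, `ℓ‖mlog E‖ ≤ s`, `ℓ²‖D*_𝒰(mlog E)‖ ≤ s`, `40s ≤ ℓ`: `max (ℓ‖Nψ − Nψ′‖) (ℓ²‖D*_𝒰(Nψ − Nψ′)‖) ≤ 400(1+3)·(p ψ + p ψ′ + s)·p(ψ − ψ′)` — EXACTLY the door's `hN`
  with `C_N = 1600` once `3·C_L·s ≤ B`.
* §4 (J-T₂) `T₂_sub`, `norm_T₂_le` — the MEMBER DOOR's `hT₂` (additivity) and `hb₂` (`‖T₂ψ‖ ≤ 12ℓ·‖ψ‖`) for px15's weighted letter.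
HONEST SCOPE.  Bookkeeping; the reality row `hNreal` (Hermitian-traceless `N ψ` on `S`) is the sequel; the analytic content is px15's.  Constants generous.
References: T. Bałaban, CMP 102 (1985) 277–309 [Balaban1985Variational] (Prop. 7 p.299); CMP 98 (1985) 17–51 [Balaban1985Averaging] ((19)–(21) p.21);
CMP 99 (1985) 389–434 [Balaban1985BackgroundPropagators] ((3.3) p.390, (3.5) p.391, (3.8) p.392); CMP 99 (1985) 75–102 [Balaban1985RegularSpaces] ((1.14) p.78).
-/

set_option autoImplicit false

noncomputable section

open scoped BigOperators Matrix.Norms.L2Operator Matrix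

namespace Summit.QuantumFields.YangMills.Theorems.Prop7ExactCorrectorHNMember

open Literature.MathematicalPhysics.QuantumFieldTheory.Balaban1983to89
open Literature.MathematicalPhysics.QuantumFieldTheory.Balaban1983to89.T3ContinuumYM3Torus
open MatrixLog (mlog)
open B9Eq39Adjoint (R R_def R_inv_R R_R_inv covD covDstar divB)
open B9TorusCalculus (torusT)
open B15DeterminingSets (embIter)
open B10Eq27TorusAxialLog (unitsField toUField)
open T4Continuum (LStep)
open Summit.QuantumFields.YangMills.BalabanUVNodes.N12RootedForestGeodesic (exists_geodesicForest)
open Summit.QuantumFields.YangMills.Theorems.Prop7CovHodgeSplit (unitsField_toUField_mem_unitary)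
open Summit.QuantumFields.YangMills.Theorems.Prop7ExactCorrectorGaugeSockets (unitsField_toUField_norm_le_one)

/-! ## §1 The torus potential: graph distance to the centres decreases along one lattice step -/

/-- ★ **A TORUS POTENTIAL TOWARD THE `k`-CENTRES**: there is `d : Site → ℕ`, zero on the centres, at most the lattice distance to every centre, and DESCENDING: from every
non-centre some lattice neighbour (forward or backward shift) has strictly smaller `d` (the rank of ✓ `exists_geodesicForest`'s breadth-first rooted forest).
[cite: Balaban1985RegularSpaces, (1.14) p.78] -/
theorem exists_torusPotential {P : Params} (k : ℕ) :
    ∃ d : Site P 0 → ℕ, (∀ y : Site P k, d (embIter k y) = 0) ∧ (∀ (x : Site P 0) (y : Site P k), d x ≤ Site.tdist x (embIter k y)) ∧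
      ∀ x : Site P 0, x ∉ Set.range (embIter k) →
        ∃ μ : Fin P.d, d (torusT P 0 μ x) + 1 ≤ d x ∨ d ((torusT P 0 μ).symm x) + 1 ≤ d x := by
  classical
  obtain ⟨path, hroot, htree, hgeo⟩ := exists_geodesicForest (Set.range (embIter k) : Set (Site P 0)) ⟨embIter k default, default, rfl⟩
  refine ⟨fun x => (path x).length, fun y => by show (path (embIter k y)).length = 0; rw [hroot _ ⟨y, rfl⟩, List.length_nil],
    fun x y => hgeo x _ ⟨y, rfl⟩, fun x hx => ?_⟩
  show ∃ μ : Fin P.d, (path (torusT P 0 μ x)).length + 1 ≤ (path x).length ∨ (path ((torusT P 0 μ).symm x)).length + 1 ≤ (path x).length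
  obtain ⟨x', s, hpath, hfwd, hbwd⟩ := htree x hx
  have hlen : (path x).length = (path x').length + 1 := by rw [hpath, List.length_append, List.length_singleton]
  refine ⟨s.bond.dir, ?_⟩
  cases hs : s.fwd
  · -- backward step: `s.bond.src = x`, `s.bond.tgt = x'`, so `x' = x.shift μ = torusT μ x`
    obtain ⟨hsrc, htgt⟩ := hbwd hs
    left
    have hx' : torusT P 0 s.bond.dir x = x' := by
      rw [← htgt, ← hsrc]; rfl
    rw [hx', hlen]
  · -- forward step: `s.bond.src = x'`, `s.bond.tgt = x`, so `x' = (torusT μ).symm x`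
    obtain ⟨hsrc, htgt⟩ := hfwd hs
    right
    have hx' : (torusT P 0 s.bond.dir).symm x = x' := by
      rw [Equiv.symm_apply_eq, ← htgt, ← hsrc]; rfl
    rw [hx', hlen]

/-! ## §2 Transport rows at a unitary background (the `hR hRn hstarR hstarRinv` of px15's shape lemmas) -/

section Transport

variable {N : ℕ}

/-- `‖R(U)M‖ = ‖M‖` for a unit with `‖U‖, ‖U⁻¹‖ ≤ 1`. [cite: Balaban1985BackgroundPropagators, (3.5) p.391] -/
theorem norm_R_eq {U : (Matrix (Fin N) (Fin N) ℂ)ˣ} (hU : ‖(U : Matrix (Fin N) (Fin N) ℂ)‖ ≤ 1 ∧ ‖((U⁻¹ : (Matrix (Fin N) (Fin N) ℂ)ˣ) : Matrix (Fin N) (Fin N) ℂ)‖ ≤ 1)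
    (M : Matrix (Fin N) (Fin N) ℂ) : ‖R U M‖ = ‖M‖ := by
  refine le_antisymm (B9Eq310Hermitian.norm_R_le hU.1 hU.2 M) ?_
  have h := B9Eq310Hermitian.norm_R_le (W := U⁻¹) hU.2 (by rw [inv_inv]; exact hU.1) (R U M)
  rwa [R_inv_R] at h

/-- `‖R(U⁻¹)M‖ = ‖M‖` likewise. [cite: Balaban1985BackgroundPropagators, (3.5) p.391] -/
theorem norm_R_inv_eq {U : (Matrix (Fin N) (Fin N) ℂ)ˣ} (hU : ‖(U : Matrix (Fin N) (Fin N) ℂ)‖ ≤ 1 ∧ ‖((U⁻¹ : (Matrix (Fin N) (Fin N) ℂ)ˣ) : Matrix (Fin N) (Fin N) ℂ)‖ ≤ 1)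
    (M : Matrix (Fin N) (Fin N) ℂ) : ‖R U⁻¹ M‖ = ‖M‖ :=
  norm_R_eq (U := U⁻¹) ⟨hU.2, by rw [inv_inv]; exact hU.1⟩ M

/-- `(R(U)M)^* = R(U)M^*` for unitary `U` (`star` = conjugate transpose). [cite: Balaban1985BackgroundPropagators, (3.5) p.391] -/
theorem star_R_eq {U : (Matrix (Fin N) (Fin N) ℂ)ˣ} (hU : (U : Matrix (Fin N) (Fin N) ℂ) ∈ unitary (Matrix (Fin N) (Fin N) ℂ))
    (M : Matrix (Fin N) (Fin N) ℂ) : star (R U M) = R U (star M) := by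
  rw [Matrix.star_eq_conjTranspose, Matrix.star_eq_conjTranspose]
  exact Prop7CovariantCoercivity.conjTranspose_R hU M

/-- `R(U⁻¹)M^* = (R(U⁻¹)M)^*` for unitary `U`. [cite: Balaban1985BackgroundPropagators, (3.5) p.391] -/
theorem R_inv_star_eq {U : (Matrix (Fin N) (Fin N) ℂ)ˣ} (hU : (U : Matrix (Fin N) (Fin N) ℂ) ∈ unitary (Matrix (Fin N) (Fin N) ℂ))
    (M : Matrix (Fin N) (Fin N) ℂ) : R U⁻¹ (star M) = star (R U⁻¹ M) :=
  (star_R_eq (Prop7CovariantCoercivity.inv_mem_unitary hU) M).symm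

end Transport


/-! ## §3 The (E1-c) → (E1-e) junction at the member: `hN0` and `hN` in the MEMBER DOOR's `q ∕ p` currency -/

section Member

open NormedSpace
open Summit.QuantumFields.YangMills.Theorems.Prop7ChartRemainderHNShape (norm_divB_chartRemainder_hN_shape)
open Summit.QuantumFields.YangMills.Theorems.Prop7ChartRemainderBondShape (norm_chartRemainder_bond_hN_shape)
open Summit.QuantumFields.YangMills.Theorems.Prop7ChartRemainderZero (chartRemainder_zero star_smul_of_hermitian)

/-- (J1) **`N 0 = 0`** for the chart remainder in the door's currency `N ψ = (−I)•(mlog(e^{cψ}·E·(R(𝒰)e^{cψ∘T})^*) − mlog E + c•D_𝒰ψ)`.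
[cite: Balaban1985Variational, Prop. 7 p.299] -/
theorem hN0_member (F : T3Family) (K : ℕ) (W : GaugeField (F.P K) 0 (Matrix.specialUnitaryGroup (Fin 2) ℂ)) (c : ℂ)
    (En : Fin (F.P K).d → Site (F.P K) 0 → Matrix (Fin 2) (Fin 2) ℂ)
    (Nf : (Site (F.P K) 0 → Matrix (Fin 2) (Fin 2) ℂ) → (Fin (F.P K).d → Site (F.P K) 0 → Matrix (Fin 2) (Fin 2) ℂ))
    (hNf : ∀ ψ μ y, Nf ψ μ y = (-Complex.I) • (mlog (exp (c • ψ y) * En μ y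
        * star (R (unitsField (toUField W) ⟨y, μ⟩) (exp (c • ψ (torusT (F.P K) 0 μ y))))) - mlog (En μ y)
        + c • covD (torusT (F.P K) 0) (fun κ z => unitsField (toUField W) ⟨z, κ⟩) μ ψ y)) :
    Nf 0 = 0 := by
  funext μ y
  have h : mlog (exp (c • (0 : Site (F.P K) 0 → Matrix (Fin 2) (Fin 2) ℂ) y) * En μ y
        * star (R (unitsField (toUField W) ⟨y, μ⟩) (exp (c • (0 : Site (F.P K) 0 → Matrix (Fin 2) (Fin 2) ℂ) (torusT (F.P K) 0 μ y))))) - mlog (En μ y)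
        + c • covD (torusT (F.P K) 0) (fun κ z => unitsField (toUField W) ⟨z, κ⟩) μ (0 : Site (F.P K) 0 → Matrix (Fin 2) (Fin 2) ℂ) y = 0 :=
    chartRemainder_zero (torusT (F.P K) 0) (fun κ z => unitsField (toUField W) ⟨z, κ⟩) c En μ y
  rw [hNf, h, smul_zero, Pi.zero_apply, Pi.zero_apply]

/-- `exp(1∕2) ≤ 2` and `exp 1 ≤ 3` (numerics for the smallness rows of px15's shape lemmas). [folklore] -/
theorem exp_half_le_two : Real.exp (1 / 2) ≤ 2 ∧ Real.exp 1 ≤ 3 := by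
  have h := Real.exp_one_lt_d9
  have h2 : Real.exp (1 / 2) * Real.exp (1 / 2) = Real.exp 1 := by rw [← Real.exp_add]; norm_num
  constructor
  · nlinarith [h, h2, Real.exp_pos (1 / 2 : ℝ)]
  · linarith

/-- ★★★ **(J2) THE `hN` ROW OF THE MEMBER DOOR FROM px15's (E1-c) SHAPE LEMMAS.**  Run `K`, level `K − n`, `SU(2)` background `W`, `𝒰 = unitsField (toUField W)`, `ℓ = L^{K−n}`; a torus
potential `d` descending toward the `(K−n)`-centres (✓ `exists_torusPotential`); `c ∈ ℂ` with `‖c‖ ≤ 1`, `c̄ = −c`; unitary-chart data `E` with `‖E − 1‖ < 1`, `ℓ‖mlog E‖ ≤ s`,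
`ℓ²‖D*_𝒰(mlog E)‖ ≤ s`, `40s ≤ ℓ`; the gauge `p ψ = max ‖ψ‖ (max (ℓ‖D_𝒰ψ‖) (ℓ‖T₂ψ‖))` with `T₂ψ(x) = min(d x, ℓ)•D*_𝒰((−c)•D_𝒰ψ)(x)` (px15's ρ-letter); the remainder `N` as displayed.
For `ψ, ψ′` pinned Hermitian traceless with `p ψ, p ψ′ ≤ B`, `400B ≤ 1`:
`max (ℓ‖Nψ − Nψ′‖) (ℓ²‖D*_𝒰(Nψ − Nψ′)‖) ≤ 1600·(p ψ + p ψ′ + s)·p(ψ − ψ′)` — the door's `hN` with `q A = max (ℓ‖A‖) (ℓ²‖D*_𝒰A‖)`, `C_N = 400(1 + d) = 1600`.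
[cite: Balaban1985Variational, Prop. 7 p.299; Balaban1985Averaging, (19)-(21) p.21] -/
theorem hN_member (F : T3Family) (K n : ℕ) (W : GaugeField (F.P K) 0 (Matrix.specialUnitaryGroup (Fin 2) ℂ))
    (d : Site (F.P K) 0 → ℕ)
    (hd : ∀ x : Site (F.P K) 0, x ∉ Set.range (embIter (K - n)) →
      ∃ μ : Fin (F.P K).d, d (torusT (F.P K) 0 μ x) + 1 ≤ d x ∨ d ((torusT (F.P K) 0 μ).symm x) + 1 ≤ d x)
    {c : ℂ} (hc : ‖c‖ ≤ 1) (hcs : star c = -c)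
    (En : Fin (F.P K).d → Site (F.P K) 0 → Matrix (Fin 2) (Fin 2) ℂ) (hE1 : ∀ μ y, ‖En μ y - 1‖ < 1) {s : ℝ}
    (hEβ : ∀ μ y, (F.L : ℝ) ^ (K - n) * ‖mlog (En μ y)‖ ≤ s)
    (hEdiv : ∀ x, ((F.L : ℝ) ^ (K - n)) ^ 2 * ‖divB (torusT (F.P K) 0) (fun κ z => unitsField (toUField W) ⟨z, κ⟩) (fun μ y => mlog (En μ y)) x‖ ≤ s)
    (hs40 : 40 * s ≤ (F.L : ℝ) ^ (K - n))
    (p : (Site (F.P K) 0 → Matrix (Fin 2) (Fin 2) ℂ) → ℝ)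
    (hp : ∀ ψ, p ψ = max ‖ψ‖ (max ((F.L : ℝ) ^ (K - n) * ‖(fun μ z => covD (torusT (F.P K) 0) (fun κ z => unitsField (toUField W) ⟨z, κ⟩) μ ψ z)‖)
      ((F.L : ℝ) ^ (K - n) * ‖(fun x => ((min (d x : ℝ) ((F.L : ℝ) ^ (K - n)) : ℝ) : ℂ) •
        divB (torusT (F.P K) 0) (fun κ z => unitsField (toUField W) ⟨z, κ⟩)
          (fun μ y => (-c) • covD (torusT (F.P K) 0) (fun κ z => unitsField (toUField W) ⟨z, κ⟩) μ ψ y) x)‖)))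
    (Nf : (Site (F.P K) 0 → Matrix (Fin 2) (Fin 2) ℂ) → (Fin (F.P K).d → Site (F.P K) 0 → Matrix (Fin 2) (Fin 2) ℂ))
    (hNf : ∀ ψ μ y, Nf ψ μ y = (-Complex.I) • (mlog (exp (c • ψ y) * En μ y
        * star (R (unitsField (toUField W) ⟨y, μ⟩) (exp (c • ψ (torusT (F.P K) 0 μ y))))) - mlog (En μ y)
        + c • covD (torusT (F.P K) 0) (fun κ z => unitsField (toUField W) ⟨z, κ⟩) μ ψ y))
    {B : ℝ} (hB : 400 * B ≤ 1) (ψ ψ' : Site (F.P K) 0 → Matrix (Fin 2) (Fin 2) ℂ)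
    (hψS : ψ ∈ {ψ : Site (F.P K) 0 → Matrix (Fin 2) (Fin 2) ℂ | (∀ c ∈ Set.range (embIter (K - n)), ψ c = 0) ∧ ∀ x, (ψ x)ᴴ = ψ x ∧ (ψ x).trace = 0})
    (hψ'S : ψ' ∈ {ψ : Site (F.P K) 0 → Matrix (Fin 2) (Fin 2) ℂ | (∀ c ∈ Set.range (embIter (K - n)), ψ c = 0) ∧ ∀ x, (ψ x)ᴴ = ψ x ∧ (ψ x).trace = 0})
    (hψB : p ψ ≤ B) (hψ'B : p ψ' ≤ B) :
    max ((F.L : ℝ) ^ (K - n) * ‖Nf ψ - Nf ψ'‖)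
        (((F.L : ℝ) ^ (K - n)) ^ 2 * ‖(fun x => divB (torusT (F.P K) 0) (fun κ z => unitsField (toUField W) ⟨z, κ⟩) (Nf ψ - Nf ψ') x)‖)
      ≤ 400 * (1 + 3) * (p ψ + p ψ' + s) * p (ψ - ψ') := by
  obtain ⟨hψC, hψHT⟩ := hψS
  obtain ⟨hψ'C, hψ'HT⟩ := hψ'S
  set T : Fin (F.P K).d → Equiv.Perm (Site (F.P K) 0) := torusT (F.P K) 0 with hTdef
  set U : Fin (F.P K).d → Site (F.P K) 0 → (Matrix (Fin 2) (Fin 2) ℂ)ˣ := fun κ z => unitsField (toUField W) ⟨z, κ⟩ with hUdef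
  have hU1 : ∀ (μ : Fin (F.P K).d) (y : Site (F.P K) 0), ‖(U μ y : Matrix (Fin 2) (Fin 2) ℂ)‖ ≤ 1 ∧ ‖(((U μ y)⁻¹ : (Matrix (Fin 2) (Fin 2) ℂ)ˣ) : Matrix (Fin 2) (Fin 2) ℂ)‖ ≤ 1 :=
    fun μ y => unitsField_toUField_norm_le_one W ⟨y, μ⟩
  have hUu : ∀ (μ : Fin (F.P K).d) (y : Site (F.P K) 0), (U μ y : Matrix (Fin 2) (Fin 2) ℂ) ∈ unitary (Matrix (Fin 2) (Fin 2) ℂ) :=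
    fun μ y => unitsField_toUField_mem_unitary W μ y
  have hR : ∀ (μ : Fin (F.P K).d) (x : Site (F.P K) 0) (M : Matrix (Fin 2) (Fin 2) ℂ), ‖R (U μ x) M‖ = ‖M‖ := fun μ x M => norm_R_eq (hU1 μ x) M
  have hRn : ∀ (μ : Fin (F.P K).d) (x : Site (F.P K) 0) (M : Matrix (Fin 2) (Fin 2) ℂ), ‖R (U μ x)⁻¹ M‖ = ‖M‖ := fun μ x M => norm_R_inv_eq (hU1 μ x) M
  have hstarR : ∀ (μ : Fin (F.P K).d) (y : Site (F.P K) 0) (M : Matrix (Fin 2) (Fin 2) ℂ), star (R (U μ y) M) = R (U μ y) (star M) :=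
    fun μ y M => star_R_eq (hUu μ y) M
  have hstarRinv : ∀ (μ : Fin (F.P K).d) (y : Site (F.P K) 0) (M : Matrix (Fin 2) (Fin 2) ℂ), R (U μ y)⁻¹ (star M) = star (R (U μ y)⁻¹ M) :=
    fun μ y M => R_inv_star_eq (hUu μ y) M
  set ℓ : ℝ := (F.L : ℝ) ^ (K - n) with hℓdef
  set ℓN : ℕ := F.L ^ (K - n) with hℓNdef
  have hL1 : 1 ≤ F.L := le_of_lt F.hL.2
  have hℓN : 1 ≤ ℓN := Nat.one_le_pow _ _ (by omega)
  have hℓcast : ((ℓN : ℕ) : ℝ) = ℓ := by rw [hℓNdef, hℓdef, Nat.cast_pow]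
  have hℓ1 : (1 : ℝ) ≤ ℓ := by rw [← hℓcast]; exact_mod_cast hℓN
  have hℓ0 : (0 : ℝ) < ℓ := by linarith
  have hskew : ∀ y, star (c • ψ y) = -(c • ψ y) := fun y =>
    star_smul_of_hermitian hcs (by rw [Matrix.star_eq_conjTranspose]; exact (hψHT y).1)
  have hskew' : ∀ y, star (c • ψ' y) = -(c • ψ' y) := fun y =>
    star_smul_of_hermitian hcs (by rw [Matrix.star_eq_conjTranspose]; exact (hψ'HT y).1)
  have hs0 : 0 ≤ s := by
    have h := hEβ 0 default
    exact (mul_nonneg hℓ0.le (norm_nonneg _)).trans h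
  have hβ : ∀ (μ : Fin (F.P K).d) (y : Site (F.P K) 0), ‖mlog (En μ y)‖ ≤ s / ℓ := fun μ y => by
    rw [le_div_iff₀ hℓ0, mul_comm]; exact hEβ μ y
  have hβ0 : 0 ≤ s / ℓ := div_nonneg hs0 hℓ0.le
  have hβ40 : s / ℓ ≤ 1 / 40 := by rw [div_le_div_iff₀ hℓ0 (by norm_num : (0:ℝ) < 40)]; linarith
  -- the three gauge components
  have hcomp : ∀ χ : Site (F.P K) 0 → Matrix (Fin 2) (Fin 2) ℂ,
      ‖χ‖ ≤ p χ ∧ ℓ * ‖(fun μ z => covD T U μ χ z)‖ ≤ p χ ∧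
        ℓ * ‖(fun x => ((min (d x : ℝ) ℓ : ℝ) : ℂ) • divB T U (fun μ y => (-c) • covD T U μ χ y) x)‖ ≤ p χ := by
    intro χ
    rw [hp χ]
    exact ⟨le_max_left _ _, (le_max_left _ _).trans (le_max_right _ _), (le_max_right _ _).trans (le_max_right _ _)⟩
  have hB400 : B ≤ 1 / 400 := by linarith
  have hP2 : p ψ ≤ 1 / 2 := by linarith [hψB]
  have hP'2 : p ψ' ≤ 1 / 2 := by linarith [hψ'B]
  have hm : ∀ y, ‖ψ y‖ ≤ ‖ψ‖ := fun y => norm_le_pi_norm ψ y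
  have hm' : ∀ y, ‖ψ' y‖ ≤ ‖ψ'‖ := fun y => norm_le_pi_norm ψ' y
  have hmd : ∀ y, ‖ψ y - ψ' y‖ ≤ ‖ψ - ψ'‖ := fun y => by rw [← Pi.sub_apply]; exact norm_le_pi_norm (ψ - ψ') y
  have hδ : ∀ (μ : Fin (F.P K).d) (y : Site (F.P K) 0), ‖covD T U μ ψ y‖ ≤ ‖(fun μ z => covD T U μ ψ z)‖ := fun μ y =>
    (norm_le_pi_norm ((fun μ z => covD T U μ ψ z) μ) y).trans (norm_le_pi_norm (fun μ z => covD T U μ ψ z) μ)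
  have hδ' : ∀ (μ : Fin (F.P K).d) (y : Site (F.P K) 0), ‖covD T U μ ψ' y‖ ≤ ‖(fun μ z => covD T U μ ψ' z)‖ := fun μ y =>
    (norm_le_pi_norm ((fun μ z => covD T U μ ψ' z) μ) y).trans (norm_le_pi_norm (fun μ z => covD T U μ ψ' z) μ)
  have hδd : ∀ (μ : Fin (F.P K).d) (y : Site (F.P K) 0), ‖covD T U μ (fun z => ψ z - ψ' z) y‖ ≤ ‖(fun μ z => covD T U μ (ψ - ψ') z)‖ := fun μ y =>
    (norm_le_pi_norm ((fun μ z => covD T U μ (ψ - ψ') z) μ) y).trans (norm_le_pi_norm (fun μ z => covD T U μ (ψ - ψ') z) μ)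
  have hmP : ‖ψ‖ ≤ p ψ := (hcomp ψ).1
  have hmR : ‖ψ‖ ≤ 1 / 2 := hmP.trans hP2
  have hm'R : ‖ψ'‖ ≤ 1 / 2 := (hcomp ψ').1.trans hP'2
  have hm'R0 : ∀ y, ‖ψ' y‖ ≤ 1 / 2 := fun y => (hm' y).trans hm'R
  have hδP : ℓ * ‖(fun μ z => covD T U μ ψ z)‖ ≤ p ψ := (hcomp ψ).2.1
  have hδ'P : ℓ * ‖(fun μ z => covD T U μ ψ' z)‖ ≤ p ψ' := (hcomp ψ').2.1
  have hδdP : ℓ * ‖(fun μ z => covD T U μ (ψ - ψ') z)‖ ≤ p (ψ - ψ') := (hcomp (ψ - ψ')).2.1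
  have hmdP : ‖ψ - ψ'‖ ≤ p (ψ - ψ') := (hcomp (ψ - ψ')).1
  -- the smallness rows of the shape lemmas
  have hδsmall : ‖(fun μ z => covD T U μ ψ z)‖ + ‖(fun μ z => covD T U μ ψ' z)‖ ≤ 1 / 200 := by
    have h1 : ‖(fun μ z => covD T U μ ψ z)‖ ≤ p ψ := (le_mul_of_one_le_left (norm_nonneg _) hℓ1).trans hδP
    have h2 : ‖(fun μ z => covD T U μ ψ' z)‖ ≤ p ψ' := (le_mul_of_one_le_left (norm_nonneg _) hℓ1).trans hδ'P
    linarith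
  have hδs0 : 0 ≤ ‖(fun μ z => covD T U μ ψ z)‖ + ‖(fun μ z => covD T U μ ψ' z)‖ := by positivity
  obtain ⟨hE2, hE3⟩ := exp_half_le_two
  have hK : Real.exp (1 / 2) * (‖(fun μ z => covD T U μ ψ z)‖ + ‖(fun μ z => covD T U μ ψ' z)‖) ≤ 1 / 80 := by nlinarith
  have hsm : Real.exp (1 / 2) * Real.exp (1 / 2 + (‖(fun μ z => covD T U μ ψ z)‖ + ‖(fun μ z => covD T U μ ψ' z)‖))
      * (‖(fun μ z => covD T U μ ψ z)‖ + ‖(fun μ z => covD T U μ ψ' z)‖) ≤ 1 / 2 := by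
    have hx : Real.exp (1 / 2 + (‖(fun μ z => covD T U μ ψ z)‖ + ‖(fun μ z => covD T U μ ψ' z)‖)) ≤ 3 :=
      (Real.exp_le_exp.2 (by linarith)).trans hE3
    have := mul_le_mul (mul_le_mul hE2 hx (Real.exp_pos _).le (by norm_num)) hδsmall hδs0 (by norm_num)
    linarith
  -- ρ rows through `T₂`
  have hρ : ∀ (χ : Site (F.P K) 0 → Matrix (Fin 2) (Fin 2) ℂ) (x : Site (F.P K) 0),
      (ℓN : ℝ) * min (d x : ℝ) (ℓN : ℝ) * ‖divB T U (fun μ y => (-c) • covD T U μ χ y) x‖ ≤ p χ := by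
    intro χ x
    have hx := norm_le_pi_norm (fun x => ((min (d x : ℝ) ℓ : ℝ) : ℂ) • divB T U (fun μ y => (-c) • covD T U μ χ y) x) x
    have hmin0 : 0 ≤ min (d x : ℝ) ℓ := le_min (Nat.cast_nonneg _) hℓ0.le
    have e : ‖((min (d x : ℝ) ℓ : ℝ) : ℂ) • divB T U (fun μ y => (-c) • covD T U μ χ y) x‖
        = min (d x : ℝ) ℓ * ‖divB T U (fun μ y => (-c) • covD T U μ χ y) x‖ := by
      rw [norm_smul, Complex.norm_real, Real.norm_of_nonneg hmin0]
    rw [hℓcast]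
    calc ℓ * min (d x : ℝ) ℓ * ‖divB T U (fun μ y => (-c) • covD T U μ χ y) x‖
        = ℓ * ‖((min (d x : ℝ) ℓ : ℝ) : ℂ) • divB T U (fun μ y => (-c) • covD T U μ χ y) x‖ := by rw [e, mul_assoc]
      _ ≤ ℓ * ‖(fun x => ((min (d x : ℝ) ℓ : ℝ) : ℂ) • divB T U (fun μ y => (-c) • covD T U μ χ y) x)‖ :=
          mul_le_mul_of_nonneg_left hx hℓ0.le
      _ ≤ p χ := (hcomp χ).2.2
  have hC : ∀ y ∈ Set.range (embIter (K - n)), ψ y = 0 := hψC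
  have hC' : ∀ y ∈ Set.range (embIter (K - n)), ψ' y = 0 := hψ'C
  have hs₀β : (ℓN : ℝ) * (s / ℓ) ≤ s := by rw [hℓcast, mul_div_cancel₀ _ hℓ0.ne']
  have hs₀div : ∀ x, (ℓN : ℝ) ^ 2 * ‖divB T U (fun μ y => mlog (En μ y)) x‖ ≤ s := fun x => by rw [hℓcast]; exact hEdiv x
  -- THE TWO SHAPE LEMMAS
  have hdivB : ∀ x, (ℓN : ℝ) ^ 2 * ‖divB T U (fun μ y =>
        (mlog (exp (c • ψ y) * En μ y * star (R (U μ y) (exp (c • ψ (T μ y))))) - mlog (En μ y) + c • covD T U μ ψ y)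
        - (mlog (exp (c • ψ' y) * En μ y * star (R (U μ y) (exp (c • ψ' (T μ y))))) - mlog (En μ y) + c • covD T U μ ψ' y)) x‖
      ≤ 400 * (1 + (Fintype.card (Fin (F.P K).d) : ℝ)) * (p ψ + p ψ' + s) * p (ψ - ψ') := fun x =>
    norm_divB_chartRemainder_hN_shape T U hR hRn hstarR hstarRinv hc ψ ψ' hskew hskew' En hE1 hβ0 hβ hβ40
      hm hmR hm' hm'R le_rfl hmd (norm_nonneg _) hδ (norm_nonneg _) hδ' (norm_nonneg _) hδd
      (Set.range (embIter (K - n))) hC hC' d hd hsm hK ℓN hℓN x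
      hmP (by rw [hℓcast]; exact hδP) hP2 (by rw [hℓcast]; exact hδ'P) hP'2 (hρ ψ' x) hmdP (by rw [hℓcast]; exact hδdP) (hρ (ψ - ψ') x) hs₀β (hs₀div x)
  have hbond : ∀ (μ : Fin (F.P K).d) (y : Site (F.P K) 0), (ℓN : ℝ) * ‖
        (mlog (exp (c • ψ y) * En μ y * star (R (U μ y) (exp (c • ψ (T μ y))))) - mlog (En μ y) + c • covD T U μ ψ y)
        - (mlog (exp (c • ψ' y) * En μ y * star (R (U μ y) (exp (c • ψ' (T μ y))))) - mlog (En μ y) + c • covD T U μ ψ' y)‖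
      ≤ 40 * (p ψ + p ψ' + s) * p (ψ - ψ') := fun μ y =>
    norm_chartRemainder_bond_hN_shape T U hR hstarR hc ψ ψ' hskew hskew' En hE1 hβ0 hβ hβ40
      hm hmR hm'R0 le_rfl hmd (norm_nonneg _) hδ (norm_nonneg _) hδ' (norm_nonneg _) hδd hsm hK ℓN hℓN μ y
      hmP (by rw [hℓcast]; exact hδP) hP2 (by rw [hℓcast]; exact hδ'P) hP'2 hmdP (by rw [hℓcast]; exact hδdP) hs₀β
  -- assembly in the door's currency
  have hd3 : (Fintype.card (Fin (F.P K).d) : ℝ) = 3 := by rw [Fintype.card_fin]; norm_num [T3Family.P_d]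
  have hPPs : 0 ≤ (p ψ + p ψ' + s) * p (ψ - ψ') :=
    mul_nonneg (by linarith [(norm_nonneg ψ).trans hmP, (norm_nonneg ψ').trans (hcomp ψ').1]) ((norm_nonneg _).trans hmdP)
  have hdiff : ∀ (μ : Fin (F.P K).d) (y : Site (F.P K) 0), (Nf ψ - Nf ψ') μ y = (-Complex.I) •
      ((mlog (exp (c • ψ y) * En μ y * star (R (U μ y) (exp (c • ψ (T μ y))))) - mlog (En μ y) + c • covD T U μ ψ y)
        - (mlog (exp (c • ψ' y) * En μ y * star (R (U μ y) (exp (c • ψ' (T μ y))))) - mlog (En μ y) + c • covD T U μ ψ' y)) := by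
    intro μ y
    rw [Pi.sub_apply, Pi.sub_apply, hNf, hNf, ← smul_sub]
  have hnI : ‖(-Complex.I)‖ = 1 := by rw [norm_neg, Complex.norm_I]
  have e40 : (40 : ℝ) * (p ψ + p ψ' + s) * p (ψ - ψ') = 40 * ((p ψ + p ψ' + s) * p (ψ - ψ')) := by ring
  have e1600 : (400 : ℝ) * (1 + 3) * (p ψ + p ψ' + s) * p (ψ - ψ') = 1600 * ((p ψ + p ψ' + s) * p (ψ - ψ')) := by ring
  have h0 : 0 ≤ 400 * (1 + 3) * (p ψ + p ψ' + s) * p (ψ - ψ') := by rw [e1600]; exact mul_nonneg (by norm_num) hPPs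
  have h40le : 40 * (p ψ + p ψ' + s) * p (ψ - ψ') ≤ 400 * (1 + 3) * (p ψ + p ψ' + s) * p (ψ - ψ') := by
    rw [e40, e1600]; exact mul_le_mul_of_nonneg_right (by norm_num) hPPs
  have hℓNpos : (0 : ℝ) < (ℓN : ℝ) := by rw [hℓcast]; exact hℓ0
  refine max_le ?_ ?_
  · -- the bond member
    rw [← hℓcast]
    have hnn : 0 ≤ (40 * (p ψ + p ψ' + s) * p (ψ - ψ')) / (ℓN : ℝ) := div_nonneg (by rw [e40]; exact mul_nonneg (by norm_num) hPPs) hℓNpos.le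
    have hbd : ∀ (μ : Fin (F.P K).d) (y : Site (F.P K) 0), ‖(Nf ψ - Nf ψ') μ y‖ ≤ (40 * (p ψ + p ψ' + s) * p (ψ - ψ')) / (ℓN : ℝ) := by
      intro μ y
      rw [hdiff μ y, norm_smul, hnI, one_mul, le_div_iff₀ hℓNpos, mul_comm]
      exact hbond μ y
    have hsup : ‖Nf ψ - Nf ψ'‖ ≤ (40 * (p ψ + p ψ' + s) * p (ψ - ψ')) / (ℓN : ℝ) :=
      (pi_norm_le_iff_of_nonneg hnn).2 fun μ => (pi_norm_le_iff_of_nonneg hnn).2 fun y => hbd μ y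
    calc (ℓN : ℝ) * ‖Nf ψ - Nf ψ'‖ ≤ (ℓN : ℝ) * ((40 * (p ψ + p ψ' + s) * p (ψ - ψ')) / (ℓN : ℝ)) :=
          mul_le_mul_of_nonneg_left hsup hℓNpos.le
      _ = 40 * (p ψ + p ψ' + s) * p (ψ - ψ') := mul_div_cancel₀ _ hℓNpos.ne'
      _ ≤ 400 * (1 + 3) * (p ψ + p ψ' + s) * p (ψ - ψ') := h40le
  · -- the divergence member
    rw [← hℓcast]
    have hfun : Nf ψ - Nf ψ' = fun μ y => (-Complex.I) •
        ((mlog (exp (c • ψ y) * En μ y * star (R (U μ y) (exp (c • ψ (T μ y))))) - mlog (En μ y) + c • covD T U μ ψ y)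
          - (mlog (exp (c • ψ' y) * En μ y * star (R (U μ y) (exp (c • ψ' (T μ y))))) - mlog (En μ y) + c • covD T U μ ψ' y)) :=
      funext fun μ => funext fun y => hdiff μ y
    have hpt : ∀ x, (ℓN : ℝ) ^ 2 * ‖divB T U (Nf ψ - Nf ψ') x‖ ≤ 400 * (1 + 3) * (p ψ + p ψ' + s) * p (ψ - ψ') := by
      intro x
      rw [hfun, B9Eq3117Current.divB_smul, norm_smul, hnI, one_mul, ← hd3]
      exact hdivB x
    have hℓN0 : (0 : ℝ) < (ℓN : ℝ) ^ 2 := by rw [hℓcast]; positivity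
    have hsup : ‖(fun x => divB T U (Nf ψ - Nf ψ') x)‖ ≤ (400 * (1 + 3) * (p ψ + p ψ' + s) * p (ψ - ψ')) / (ℓN : ℝ) ^ 2 := by
      refine (pi_norm_le_iff_of_nonneg (div_nonneg h0 hℓN0.le)).2 fun x => ?_
      rw [le_div_iff₀ hℓN0, mul_comm]
      exact hpt x
    calc (ℓN : ℝ) ^ 2 * ‖(fun x => divB T U (Nf ψ - Nf ψ') x)‖
        ≤ (ℓN : ℝ) ^ 2 * ((400 * (1 + 3) * (p ψ + p ψ' + s) * p (ψ - ψ')) / (ℓN : ℝ) ^ 2) := mul_le_mul_of_nonneg_left hsup hℓN0.le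
      _ = 400 * (1 + 3) * (p ψ + p ψ' + s) * p (ψ - ψ') := mul_div_cancel₀ _ hℓN0.ne'

/-! ## §4 (J-T₂) The weighted letter `T₂ψ(x) = min(d x, ℓ)•D*_𝒰((−c)•D_𝒰ψ)(x)`: additivity and sup bound (the MEMBER DOOR's `hT₂ hb₂`) -/

/-- (J-T₂) `T₂` is additive. [cite: Balaban1985BackgroundPropagators, (3.8) p.392] -/
theorem T₂_sub (F : T3Family) (K n : ℕ) (W : GaugeField (F.P K) 0 (Matrix.specialUnitaryGroup (Fin 2) ℂ)) (d : Site (F.P K) 0 → ℕ) (c : ℂ)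
    (a b : Site (F.P K) 0 → Matrix (Fin 2) (Fin 2) ℂ) :
    (fun x => ((min (d x : ℝ) ((F.L : ℝ) ^ (K - n)) : ℝ) : ℂ) •
        divB (torusT (F.P K) 0) (fun κ z => unitsField (toUField W) ⟨z, κ⟩)
          (fun μ y => (-c) • covD (torusT (F.P K) 0) (fun κ z => unitsField (toUField W) ⟨z, κ⟩) μ (a - b) y) x)
      = (fun x => ((min (d x : ℝ) ((F.L : ℝ) ^ (K - n)) : ℝ) : ℂ) •
          divB (torusT (F.P K) 0) (fun κ z => unitsField (toUField W) ⟨z, κ⟩)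
            (fun μ y => (-c) • covD (torusT (F.P K) 0) (fun κ z => unitsField (toUField W) ⟨z, κ⟩) μ a y) x)
        - (fun x => ((min (d x : ℝ) ((F.L : ℝ) ^ (K - n)) : ℝ) : ℂ) •
          divB (torusT (F.P K) 0) (fun κ z => unitsField (toUField W) ⟨z, κ⟩)
            (fun μ y => (-c) • covD (torusT (F.P K) 0) (fun κ z => unitsField (toUField W) ⟨z, κ⟩) μ b y) x) := by
  funext x
  have e : (fun μ y => (-c) • covD (torusT (F.P K) 0) (fun κ z => unitsField (toUField W) ⟨z, κ⟩) μ (a - b) y)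
      = (fun μ y => (-c) • covD (torusT (F.P K) 0) (fun κ z => unitsField (toUField W) ⟨z, κ⟩) μ a y)
        - (fun μ y => (-c) • covD (torusT (F.P K) 0) (fun κ z => unitsField (toUField W) ⟨z, κ⟩) μ b y) := by
    funext μ y
    simp only [Pi.sub_apply, B9Eq39Adjoint.covD_sub, smul_sub]
  rw [Pi.sub_apply, e, Prop7ExactCorrectorGaugeSockets.divB_sub, smul_sub]

/-- (J-T₂) `‖T₂ψ‖ ≤ 12ℓ·‖ψ‖` (`min(d x, ℓ) ≤ ℓ`, `‖c‖ ≤ 1`, `‖D*_𝒰D_𝒰ψ‖ ≤ 4d‖ψ‖` at the unitary background). [cite: Balaban1985BackgroundPropagators, (3.8) p.392] -/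
theorem norm_T₂_le (F : T3Family) (K n : ℕ) (W : GaugeField (F.P K) 0 (Matrix.specialUnitaryGroup (Fin 2) ℂ)) (d : Site (F.P K) 0 → ℕ) {c : ℂ} (hc : ‖c‖ ≤ 1)
    (ψ : Site (F.P K) 0 → Matrix (Fin 2) (Fin 2) ℂ) :
    ‖(fun x => ((min (d x : ℝ) ((F.L : ℝ) ^ (K - n)) : ℝ) : ℂ) •
        divB (torusT (F.P K) 0) (fun κ z => unitsField (toUField W) ⟨z, κ⟩)
          (fun μ y => (-c) • covD (torusT (F.P K) 0) (fun κ z => unitsField (toUField W) ⟨z, κ⟩) μ ψ y) x)‖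
      ≤ (F.L : ℝ) ^ (K - n) * 12 * ‖ψ‖ := by
  have hℓ0 : (0 : ℝ) ≤ (F.L : ℝ) ^ (K - n) := pow_nonneg (Nat.cast_nonneg _) _
  have hU1 : ∀ (μ : Fin (F.P K).d) (y : Site (F.P K) 0), ‖((fun κ z => unitsField (toUField W) ⟨z, κ⟩) μ y : Matrix (Fin 2) (Fin 2) ℂ)‖ ≤ 1 ∧
      ‖((((fun κ z => unitsField (toUField W) ⟨z, κ⟩) μ y)⁻¹ : (Matrix (Fin 2) (Fin 2) ℂ)ˣ) : Matrix (Fin 2) (Fin 2) ℂ)‖ ≤ 1 :=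
    fun μ y => unitsField_toUField_norm_le_one W ⟨y, μ⟩
  refine (pi_norm_le_iff_of_nonneg (by positivity)).2 fun x => ?_
  have hmin0 : 0 ≤ min (d x : ℝ) ((F.L : ℝ) ^ (K - n)) := le_min (Nat.cast_nonneg _) hℓ0
  have hminℓ : min (d x : ℝ) ((F.L : ℝ) ^ (K - n)) ≤ (F.L : ℝ) ^ (K - n) := min_le_right _ _
  have hlap := Prop7ExactCorrectorGaugeSockets.norm_lapW_le (torusT (F.P K) 0) (fun κ z => unitsField (toUField W) ⟨z, κ⟩) hU1 ψ x
  rw [norm_smul, Complex.norm_real, Real.norm_of_nonneg hmin0, B9Eq3117Current.divB_smul, norm_smul, norm_neg]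
  have hd3 : (Fintype.card (Fin (F.P K).d) : ℝ) = 3 := by rw [Fintype.card_fin]; norm_num [T3Family.P_d]
  rw [hd3] at hlap
  have hψ0 : 0 ≤ ‖ψ‖ := norm_nonneg _
  calc min (d x : ℝ) ((F.L : ℝ) ^ (K - n)) * (‖c‖ * ‖divB (torusT (F.P K) 0) (fun κ z => unitsField (toUField W) ⟨z, κ⟩)
          (fun μ z => covD (torusT (F.P K) 0) (fun κ z => unitsField (toUField W) ⟨z, κ⟩) μ ψ z) x‖)
      ≤ (F.L : ℝ) ^ (K - n) * (1 * (4 * 3 * ‖ψ‖)) := by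
        refine mul_le_mul hminℓ (mul_le_mul hc hlap (norm_nonneg _) zero_le_one) (mul_nonneg (norm_nonneg _) (norm_nonneg _)) hℓ0
    _ = (F.L : ℝ) ^ (K - n) * 12 * ‖ψ‖ := by ring

end Member

end Summit.QuantumFields.YangMills.Theorems.Prop7ExactCorrectorHNMember

end
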